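import Summits.BirchSwinnertonDyer.BirchSwinnertonDyer.Theorems.ManinLocalTwoThreeManinPrimeToAdditiveFiveLeUpperAnchorOfFacts
import Summits.BirchSwinnertonDyer.BirchSwinnertonDyer.Theorems.EdixhovenFibreFiveSevenStarredOptimalManinUnitFiveSeven
import HarnessLib

/-!
# Route `ManinLocalTwoThree`, residual crux C5 `ManinPrimeToAdditiveFiveLe`
# (stmt-BirchSwinnertonDyer-22969), line `upper_anchor`: STUB 3 `stub_upperAnchor` GRANTED
# Edixhoven 1991 Thm. 3 and crux K★ `StarredOptimalManinUnitFiveSeven` BY NAME / Kato's fact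

Thin glue (deliberately separate from the route-independent core
`ManinLocalTwoThreeManinPrimeToAdditiveFiveLeUpperAnchorOfFacts`, because naming crux K★ imports the
route file `Theses.EdixhovenFibreFiveSeven`): the registered signature of `stub_upperAnchor`
(skeleton `Cruxes/ManinPrimeToAdditiveFiveLe/Lines/upper_anchor.lean`, sha16 b6313bd2b9b9b148)
VERBATIM as the conclusion, GRANTED

* `upperAnchor_of_edixhovenKodairaFact_of_kstar`: (i) the cite-only Literature fact
  `edixhoven_not_dvd_maninConstant_of_kodairaSymbol_ne` (Edixhoven 1991 Thm. 3, Kodaira-type half)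
  and (ii) crux K★ `Theses.EdixhovenFibreFiveSeven.StarredOptimalManinUnitFiveSeven`
  (stmt-BirchSwinnertonDyer-22226) BY NAME;
* `upperAnchor_of_edixhovenKodairaFact_of_kato`: (i) and Kato's Néron integrality of the twisted
  symbol sum at an additive `p ≥ 5` (`kato_neron_isIntegral_twistedSymbolSum_of_additive_five_le`,
  cite-only; Kato 2004 (8.1.3)/Thm. 9.7 + Kim–Nakamura 2020 + Kosters–Pannekoek 2017), through the
  landed conditional theorem `starredOptimalManinUnitFiveSeven_of_kato` (p581141).

So the ENTIRE open content of stub 3 is {Edixhoven Thm. 3 as printed} ∪ {Kato's (F″) as printed}: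
two PUBLISHED inputs, neither a hypothesis of C5 — conditional-result (`--supports … --as helper`);
the registered stub stays `sorry` in the skeleton. Nothing here proves BSD, Manin's conjecture or
C5. Seat bsd-line-ml23-c5-p1-w2 (width prover).

References: [EdixhovenManin1991] Thm. 3; [Kato2004Asterisque] (8.1.3), Thm. 9.7;
[KimNakamura2020] Cor. 2.4; [KostersPannekoek2017] Thm. 1.
-/

set_option autoImplicit false
-- the Theorems namespace of this sub repeats the summit name by design (D-0017 nested layout)
set_option linter.dupNamespace false

noncomputable section

namespace Summit.BirchSwinnertonDyer.BirchSwinnertonDyer.Theorems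

open WeierstrassCurve Literature.NumberTheory.EllipticCurves
  Literature.NumberTheory.EllipticCurves.ModularForms
  Summit.BirchSwinnertonDyer.Rank1Residual.ManinAdditive

/-- **STUB 3 `stub_upperAnchor` (registered signature verbatim) GRANTED Edixhoven 1991 Thm. 3
(Kodaira-type form, cite-only) and crux K★ `StarredOptimalManinUnitFiveSeven` (stmt-22226) BY NAME.**
Conditional-result. [cite: EdixhovenManin1991, Thm. 3] -/
theorem upperAnchor_of_edixhovenKodairaFact_of_kstar
    (hEd : edixhoven_not_dvd_maninConstant_of_kodairaSymbol_ne)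
    (hK : Summit.BirchSwinnertonDyer.BirchSwinnertonDyer.Theses.EdixhovenFibreFiveSeven.StarredOptimalManinUnitFiveSeven) :
    exists_isNewformOf →
    ∀ {p : ℕ}, p.Prime → 5 ≤ p →
    ∀ (W W' : WeierstrassCurve ℚ) [W.IsElliptic] [W.IsGloballyMinimal] [W'.IsElliptic]
      [W'.IsGloballyMinimal] [NeZero (W.conductorNorm ℤ)] [NeZero (W'.conductorNorm ℤ)]
      (u : VariableChange ℚ) (D : ModularParametrizationData W (W.conductorNorm ℤ))
      (D' : ModularParametrizationData W' (W'.conductorNorm ℤ)),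
      IsLatticeOptimal D → IsLatticeOptimal D' →
      p ^ 2 ∣ W.conductorNorm ℤ → W'.conductorNorm ℤ = W.conductorNorm ℤ →
      u • W.quadraticTwist ((((-1 : ℤ) ^ (p / 2) * p : ℤ)) : ℚ) = W' →
      W.HasIrreducibleModPGaloisRep p →
      padicValInt p W'.minimalDiscriminantInt = padicValInt p W.minimalDiscriminantInt + 6 →
      ¬ (p : ℤ) ∣ D'.maninConstant :=
  upperAnchor_of_edixhovenKodairaFact_of_starred hEd hK

/-- **STUB 3 `stub_upperAnchor` (registered signature verbatim) GRANTED two PRINTED inputs only**: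
Edixhoven 1991 Thm. 3 (Kodaira-type form) and Kato's Néron integrality (F″)
`kato_neron_isIntegral_twistedSymbolSum_of_additive_five_le`, via the landed
`starredOptimalManinUnitFiveSeven_of_kato` (p581141). Conditional-result; BSD is not proved by this.
[cite: EdixhovenManin1991, Thm. 3] [cite: Kato2004Asterisque, (8.1.3) (p. 180), Thm. 9.7 (p. 189)] -/
theorem upperAnchor_of_edixhovenKodairaFact_of_kato
    (hEd : edixhoven_not_dvd_maninConstant_of_kodairaSymbol_ne)
    (hKato : kato_neron_isIntegral_twistedSymbolSum_of_additive_five_le) :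
    exists_isNewformOf →
    ∀ {p : ℕ}, p.Prime → 5 ≤ p →
    ∀ (W W' : WeierstrassCurve ℚ) [W.IsElliptic] [W.IsGloballyMinimal] [W'.IsElliptic]
      [W'.IsGloballyMinimal] [NeZero (W.conductorNorm ℤ)] [NeZero (W'.conductorNorm ℤ)]
      (u : VariableChange ℚ) (D : ModularParametrizationData W (W.conductorNorm ℤ))
      (D' : ModularParametrizationData W' (W'.conductorNorm ℤ)),
      IsLatticeOptimal D → IsLatticeOptimal D' →
      p ^ 2 ∣ W.conductorNorm ℤ → W'.conductorNorm ℤ = W.conductorNorm ℤ →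
      u • W.quadraticTwist ((((-1 : ℤ) ^ (p / 2) * p : ℤ)) : ℚ) = W' →
      W.HasIrreducibleModPGaloisRep p →
      padicValInt p W'.minimalDiscriminantInt = padicValInt p W.minimalDiscriminantInt + 6 →
      ¬ (p : ℤ) ∣ D'.maninConstant :=
  upperAnchor_of_edixhovenKodairaFact_of_starred hEd (starredOptimalManinUnitFiveSeven_of_kato hKato)

end Summit.BirchSwinnertonDyer.BirchSwinnertonDyer.Theorems

end
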